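import Summits.QuantumFields.BalabanUV.Beta.GAN24.TransversalZeroMode

/-!
# `BalabanUV.Beta.GAN24.TransversalZeroModeLoc` — binder row G-an2-4 / (CONV-C), W-slot road «W3» (SKELETON-W3 v1.0.2 §8.3/§8.5), part 2 of the
# bridge «W3-ZPT*»: THE TRANSVERSAL INNER SUM OF A `LocStencil₂` TABLE — absolute convergence on `Site³`, additivity WITHOUT extra hypotheses,
# and ORDER INDEPENDENCE (`Σ'_{u′} Σ'_x Σ'_z = Σ'_z Σ'_x Σ'_{u′}`, the order in which a three-leg slice push meets it)

NOT IN PRINT; OUR BOOKKEEPING (G-an2-4 formalisation swarm, leaf prover `b2b-balaban-gan24-formalise-leaf-16`, gen 12; journal NOTE «ZFREE-POINTWISE»,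
INTENT «W3-ZPT*» — same stamp, disjoint second module; name PROVISIONAL).  HONEST FRAMING (cell contract, verbatim): «discharging `BetaPertH` makes
Bałaban's UV stability UNCONDITIONAL — a real constructive-QFT result; it is NOT the continuum limit and NOT the Clay problem.»  HONEST DEPENDENCY
(verbatim): «continuum YM on T⁴ ⇐ BetaPertH ∧ nine spine estimates (0/9 proved); BetaPertH ⇐ (D1) ∧ (D4) ∧ CAP+tail; G-an2-4 gates asym, D1 and NE2/3/4.»

WHY.  Part 1 (`TransversalZeroMode`) stated the additivity of the pointwise zero mode `Σ'_{u′} Σ'_x Σ'_z X κ u κ′ u′ x z a b` under six nested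
summability hypotheses, importing no decay currency.  Every table of road W3 is a `BalabanCompositeJets.LocStencil₂` family at a positive rate, whose
slices carry the product majorant `C·e^{−δ|u′−u|₁}·e^{−δ|x−u|₁}·e^{−δ|z−u|₁}`; this module discharges the summabilities once and for all (§1), so that
the takers of rows W3-F2a/F2b/F4d add and subtract inner sums of `LocStencil₂` tables with NO side conditions (§2), and records that the inner sum
may be read in ANY nesting order (§3) — in particular in the order `Σ'_z Σ'_x Σ'_{u′}` in which the three-leg push of the slice `X κ u` (the
`u`-outer form of leaf-17's `push₄`, `Push4NestTable.vertexW_comp_left`/`_right`) produces it, which is where row W3-F3b's one-Taylor-order argument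
subtracts it.
WHAT ([folklore]; generic `d`; `LocStencil₂ X C δ` with `0 < δ` throughout):
* §1 `abs_le_prod_of_locStencil₂` (the product majorant), `summable_z`, `summable_xz`, `summable_x_tsum_z`, `summable_u'xz`, `summable_u'_tsum_xz`
  (absolute convergence of the slice on `Site`, `Site²`, `Site³` and of the partial sums), `abs_inner_le` (`|Σ'_{u′xz} X …| ≤ C·Zl(δ)³`).
* §2 `inner_add_of_locStencil₂`, `inner_sub_of_locStencil₂`, `inner_sub_eq_zero_of_locStencil₂` (part 1's `inner_add_eq`/`inner_sub_eq` with the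
  six summabilities discharged).
* §3 `inner_eq_tsum_prod` (the inner sum is ONE absolutely convergent sum over `Site × (Site × Site)`), **`inner_eq_inner_zxu`**
  (`Σ'_{u′} Σ'_x Σ'_z X … = Σ'_z Σ'_x Σ'_{u′} X …`).
0 `def`, 0 cite, 0 `def … : Prop`, 0 sorry; asserts NO shape and NO zero mode of Bałaban's tables; NOT a row of SKELETON-W3; discharges NOTHING of
(hW, hWall); NOT «W-slot closed», NEVER «G-an2-4 closed»; NOT BetaPertH, NOT continuum, NOT Clay.
-/

noncomputable section

open Finset
open scoped BigOperators
open Literature.MathematicalPhysics.QuantumFieldTheory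
open Literature.MathematicalPhysics.QuantumFieldTheory.Balaban1983to89
open Literature.MathematicalPhysics.QuantumFieldTheory.Balaban1983to89.Beta
open B12Sec2to5 (l1 l1_nonneg)
open ExpKernelCalculus (MKer shiftK Zl Zl_nonneg summable_exp_shift' tsum_exp_shift')
open OneStepResolventKernel (Fib)
open BalabanCompositeJets (LocStencil₂)
open Summit.QuantumFields.BalabanUV.Beta.GAN24.BiStencilZeroMode (Tab)
open Summit.QuantumFields.BalabanUV.Beta.GAN24.TransversalZeroMode (inner_add_eq inner_sub_eq)

namespace Summit.QuantumFields.BalabanUV.Beta.GAN24.TransversalZeroModeLoc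

variable {d : ℕ} {X Y : Tab d} {C C' δ δ' : ℝ}

/-! ## §1 The product majorant of a `LocStencil₂` slice and the summabilities it gives -/

/-- [folklore] **THE PRODUCT MAJORANT**: `|X κ u κ′ u′ x z a b| ≤ C·e^{−δ|u′−u|₁} · (e^{−δ|x−u|₁} · e^{−δ|z−u|₁})` (the `LocStencil₂` bound with the
exponential of the sum split). -/
theorem abs_le_prod_of_locStencil₂ (hX : LocStencil₂ X C δ) (κ : Fin (d + 1)) (u : Fin (d + 1) → ℤ) (κ' : Fin (d + 1))
    (u' x z : Fin (d + 1) → ℤ) (a b : Fib d) :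
    |X κ u κ' u' x z a b| ≤ C * Real.exp (-δ * l1 (u' - u)) * (Real.exp (-δ * l1 (x - u)) * Real.exp (-δ * l1 (z - u))) := by
  have h := hX κ u κ' u' x z a b
  rwa [mul_add, Real.exp_add] at h

/-- [folklore] The constant of a `LocStencil₂` bound is nonnegative (re-export of an2's `LocStencil₂.nonneg`). -/
theorem nonneg_of_locStencil₂ (hX : LocStencil₂ X C δ) : 0 ≤ C := hX.nonneg

/-- [folklore] The `z`-slice is absolutely summable. -/
theorem summable_z (hX : LocStencil₂ X C δ) (hδ : 0 < δ) (κ : Fin (d + 1)) (u : Fin (d + 1) → ℤ) (κ' : Fin (d + 1))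
    (u' x : Fin (d + 1) → ℤ) (a b : Fib d) : Summable fun z => X κ u κ' u' x z a b := by
  refine Summable.of_norm_bounded ((summable_exp_shift' hδ u).mul_left
    (C * Real.exp (-δ * l1 (u' - u)) * Real.exp (-δ * l1 (x - u)))) (fun z => ?_)
  rw [Real.norm_eq_abs]
  calc |X κ u κ' u' x z a b| ≤ C * Real.exp (-δ * l1 (u' - u)) * (Real.exp (-δ * l1 (x - u)) * Real.exp (-δ * l1 (z - u))) :=
        abs_le_prod_of_locStencil₂ hX κ u κ' u' x z a b
    _ = C * Real.exp (-δ * l1 (u' - u)) * Real.exp (-δ * l1 (x - u)) * Real.exp (-δ * l1 (z - u)) := by ring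

/-- [folklore] The `(x, z)`-slice is absolutely summable on `Site × Site`. -/
theorem summable_xz (hX : LocStencil₂ X C δ) (hδ : 0 < δ) (κ : Fin (d + 1)) (u : Fin (d + 1) → ℤ) (κ' : Fin (d + 1))
    (u' : Fin (d + 1) → ℤ) (a b : Fib d) : Summable fun p : (Fin (d + 1) → ℤ) × (Fin (d + 1) → ℤ) => X κ u κ' u' p.1 p.2 a b := by
  have hprod : Summable fun p : (Fin (d + 1) → ℤ) × (Fin (d + 1) → ℤ) =>
      Real.exp (-δ * l1 (p.1 - u)) * Real.exp (-δ * l1 (p.2 - u)) :=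
    (summable_exp_shift' hδ u).mul_of_nonneg (summable_exp_shift' hδ u) (fun _ => (Real.exp_pos _).le) (fun _ => (Real.exp_pos _).le)
  refine Summable.of_norm_bounded (hprod.mul_left (C * Real.exp (-δ * l1 (u' - u)))) (fun p => ?_)
  rw [Real.norm_eq_abs]
  exact abs_le_prod_of_locStencil₂ hX κ u κ' u' p.1 p.2 a b

/-- [folklore] The partial sums `x ↦ Σ'_z X … x z …` are summable. -/
theorem summable_x_tsum_z (hX : LocStencil₂ X C δ) (hδ : 0 < δ) (κ : Fin (d + 1)) (u : Fin (d + 1) → ℤ) (κ' : Fin (d + 1))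
    (u' : Fin (d + 1) → ℤ) (a b : Fib d) : Summable fun x => ∑' z, X κ u κ' u' x z a b :=
  (summable_xz hX hδ κ u κ' u' a b).prod

/-- [folklore] The whole slice is absolutely summable on `Site × (Site × Site)` (variables `(u′, (x, z))`). -/
theorem summable_u'xz (hX : LocStencil₂ X C δ) (hδ : 0 < δ) (κ : Fin (d + 1)) (u : Fin (d + 1) → ℤ) (κ' : Fin (d + 1)) (a b : Fib d) :
    Summable fun q : (Fin (d + 1) → ℤ) × ((Fin (d + 1) → ℤ) × (Fin (d + 1) → ℤ)) => X κ u κ' q.1 q.2.1 q.2.2 a b := by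
  set φ : (Fin (d + 1) → ℤ) → ℝ := fun v => Real.exp (-δ * l1 (v - u)) with hφ
  have hφs : Summable φ := summable_exp_shift' hδ u
  have hφ0 : ∀ v, 0 ≤ φ v := fun v => (Real.exp_pos _).le
  set ψ : (Fin (d + 1) → ℤ) × (Fin (d + 1) → ℤ) → ℝ := fun p => φ p.1 * φ p.2 with hψ
  have hψs : Summable ψ := hφs.mul_of_nonneg hφs hφ0 hφ0
  have hψ0 : ∀ p, 0 ≤ ψ p := fun p => mul_nonneg (hφ0 _) (hφ0 _)
  set M : (Fin (d + 1) → ℤ) × ((Fin (d + 1) → ℤ) × (Fin (d + 1) → ℤ)) → ℝ := fun q => φ q.1 * ψ q.2 with hM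
  have hMs : Summable M := hφs.mul_of_nonneg hψs hφ0 hψ0
  refine Summable.of_norm_bounded (hMs.mul_left C) (fun q => ?_)
  rw [Real.norm_eq_abs]
  have h := abs_le_prod_of_locStencil₂ hX κ u κ' q.1 q.2.1 q.2.2 a b
  calc |X κ u κ' q.1 q.2.1 q.2.2 a b|
        ≤ C * Real.exp (-δ * l1 (q.1 - u)) * (Real.exp (-δ * l1 (q.2.1 - u)) * Real.exp (-δ * l1 (q.2.2 - u))) := h
    _ = C * M q := by simp only [hM, hψ, hφ]; ring

/-- [folklore] For each `u′` the double sum over `(x, z)` is the iterated sum. -/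
theorem tsum_xz_eq (hX : LocStencil₂ X C δ) (hδ : 0 < δ) (κ : Fin (d + 1)) (u : Fin (d + 1) → ℤ) (κ' : Fin (d + 1))
    (u' : Fin (d + 1) → ℤ) (a b : Fib d) :
    (∑' p : (Fin (d + 1) → ℤ) × (Fin (d + 1) → ℤ), X κ u κ' u' p.1 p.2 a b) = ∑' x, ∑' z, X κ u κ' u' x z a b :=
  (summable_xz hX hδ κ u κ' u' a b).tsum_prod

/-- [folklore] The partial sums `u′ ↦ Σ'_x Σ'_z X … u′ x z …` are summable. -/
theorem summable_u'_tsum_xz (hX : LocStencil₂ X C δ) (hδ : 0 < δ) (κ : Fin (d + 1)) (u : Fin (d + 1) → ℤ) (κ' : Fin (d + 1))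
    (a b : Fib d) : Summable fun u' => ∑' x, ∑' z, X κ u κ' u' x z a b := by
  have h := (summable_u'xz hX hδ κ u κ' a b).prod
  refine h.congr fun u' => ?_
  exact tsum_xz_eq hX hδ κ u κ' u' a b

/-- [folklore] **THE INNER SUM IS ONE ABSOLUTELY CONVERGENT SUM OVER `Site × (Site × Site)`.** -/
theorem inner_eq_tsum_prod (hX : LocStencil₂ X C δ) (hδ : 0 < δ) (κ : Fin (d + 1)) (u : Fin (d + 1) → ℤ) (κ' : Fin (d + 1))
    (a b : Fib d) :
    (∑' u', ∑' x, ∑' z, X κ u κ' u' x z a b)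
      = ∑' q : (Fin (d + 1) → ℤ) × ((Fin (d + 1) → ℤ) × (Fin (d + 1) → ℤ)), X κ u κ' q.1 q.2.1 q.2.2 a b := by
  rw [(summable_u'xz hX hδ κ u κ' a b).tsum_prod]
  exact tsum_congr fun u' => (tsum_xz_eq hX hδ κ u κ' u' a b).symm

/-- [folklore] **SIZE OF THE INNER SUM**: `|Σ'_{u′} Σ'_x Σ'_z X κ u κ′ u′ x z a b| ≤ C · Zl(δ)³`. -/
theorem abs_inner_le (hX : LocStencil₂ X C δ) (hδ : 0 < δ) (κ : Fin (d + 1)) (u : Fin (d + 1) → ℤ) (κ' : Fin (d + 1))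
    (a b : Fib d) :
    |∑' u', ∑' x, ∑' z, X κ u κ' u' x z a b| ≤ C * Zl (d + 1) δ ^ 3 := by
  have hC : 0 ≤ C := hX.nonneg
  -- innermost
  have hz : ∀ u' x, |∑' z, X κ u κ' u' x z a b| ≤ C * Real.exp (-δ * l1 (u' - u)) * Real.exp (-δ * l1 (x - u)) * Zl (d + 1) δ := by
    intro u' x
    have hs := summable_z hX hδ κ u κ' u' x a b
    calc |∑' z, X κ u κ' u' x z a b| ≤ ∑' z, |X κ u κ' u' x z a b| := by
            rw [← Real.norm_eq_abs]; exact norm_tsum_le_tsum_norm hs.norm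
      _ ≤ ∑' z, C * Real.exp (-δ * l1 (u' - u)) * Real.exp (-δ * l1 (x - u)) * Real.exp (-δ * l1 (z - u)) :=
            Summable.tsum_le_tsum (fun z => by
                calc |X κ u κ' u' x z a b| ≤ _ := abs_le_prod_of_locStencil₂ hX κ u κ' u' x z a b
                  _ = _ := by ring)
              hs.abs ((summable_exp_shift' hδ u).mul_left _)
      _ = C * Real.exp (-δ * l1 (u' - u)) * Real.exp (-δ * l1 (x - u)) * Zl (d + 1) δ := by
            rw [tsum_mul_left, tsum_exp_shift']
  -- middle
  have hx : ∀ u', |∑' x, ∑' z, X κ u κ' u' x z a b| ≤ C * Real.exp (-δ * l1 (u' - u)) * Zl (d + 1) δ * Zl (d + 1) δ := by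
    intro u'
    have hs := summable_x_tsum_z hX hδ κ u κ' u' a b
    calc |∑' x, ∑' z, X κ u κ' u' x z a b| ≤ ∑' x, |∑' z, X κ u κ' u' x z a b| := by
            rw [← Real.norm_eq_abs]; exact norm_tsum_le_tsum_norm hs.norm
      _ ≤ ∑' x, C * Real.exp (-δ * l1 (u' - u)) * Zl (d + 1) δ * Real.exp (-δ * l1 (x - u)) :=
            Summable.tsum_le_tsum (fun x => by
                calc |∑' z, X κ u κ' u' x z a b| ≤ _ := hz u' x
                  _ = _ := by ring)
              hs.abs ((summable_exp_shift' hδ u).mul_left _)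
      _ = C * Real.exp (-δ * l1 (u' - u)) * Zl (d + 1) δ * Zl (d + 1) δ := by
            rw [tsum_mul_left, tsum_exp_shift']
  -- outer
  have hs := summable_u'_tsum_xz hX hδ κ u κ' a b
  calc |∑' u', ∑' x, ∑' z, X κ u κ' u' x z a b| ≤ ∑' u', |∑' x, ∑' z, X κ u κ' u' x z a b| := by
          rw [← Real.norm_eq_abs]; exact norm_tsum_le_tsum_norm hs.norm
    _ ≤ ∑' u', C * Zl (d + 1) δ * Zl (d + 1) δ * Real.exp (-δ * l1 (u' - u)) :=
          Summable.tsum_le_tsum (fun u' => by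
              calc |∑' x, ∑' z, X κ u κ' u' x z a b| ≤ _ := hx u'
                _ = _ := by ring)
            hs.abs ((summable_exp_shift' hδ u).mul_left _)
    _ = C * Zl (d + 1) δ * Zl (d + 1) δ * Zl (d + 1) δ := by rw [tsum_mul_left, tsum_exp_shift']
    _ = C * Zl (d + 1) δ ^ 3 := by ring

/-! ## §2 Additivity of the inner sum for `LocStencil₂` tables — no side conditions -/

/-- [folklore] **INNER SUMS ADD** for two `LocStencil₂` tables (any two positive rates). -/
theorem inner_add_of_locStencil₂ (hX : LocStencil₂ X C δ) (hδ : 0 < δ) (hY : LocStencil₂ Y C' δ') (hδ' : 0 < δ')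
    (κ : Fin (d + 1)) (u : Fin (d + 1) → ℤ) (κ' : Fin (d + 1)) (a b : Fib d) :
    (∑' u', ∑' x, ∑' z, (X + Y) κ u κ' u' x z a b)
      = (∑' u', ∑' x, ∑' z, X κ u κ' u' x z a b) + ∑' u', ∑' x, ∑' z, Y κ u κ' u' x z a b :=
  inner_add_eq κ u κ' a b (fun u' x => summable_z hX hδ κ u κ' u' x a b) (fun u' x => summable_z hY hδ' κ u κ' u' x a b)
    (fun u' => summable_x_tsum_z hX hδ κ u κ' u' a b) (fun u' => summable_x_tsum_z hY hδ' κ u κ' u' a b)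
    (summable_u'_tsum_xz hX hδ κ u κ' a b) (summable_u'_tsum_xz hY hδ' κ u κ' a b)

/-- [folklore] **INNER SUMS SUBTRACT** for two `LocStencil₂` tables (the first difference `T♮_1 − T♮_0` of row W3-F4d; the forcing of row W3-F2b). -/
theorem inner_sub_of_locStencil₂ (hX : LocStencil₂ X C δ) (hδ : 0 < δ) (hY : LocStencil₂ Y C' δ') (hδ' : 0 < δ')
    (κ : Fin (d + 1)) (u : Fin (d + 1) → ℤ) (κ' : Fin (d + 1)) (a b : Fib d) :
    (∑' u', ∑' x, ∑' z, (X - Y) κ u κ' u' x z a b)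
      = (∑' u', ∑' x, ∑' z, X κ u κ' u' x z a b) - ∑' u', ∑' x, ∑' z, Y κ u κ' u' x z a b :=
  inner_sub_eq κ u κ' a b (fun u' x => summable_z hX hδ κ u κ' u' x a b) (fun u' x => summable_z hY hδ' κ u κ' u' x a b)
    (fun u' => summable_x_tsum_z hX hδ κ u κ' u' a b) (fun u' => summable_x_tsum_z hY hδ' κ u κ' u' a b)
    (summable_u'_tsum_xz hX hδ κ u κ' a b) (summable_u'_tsum_xz hY hδ' κ u κ' a b)

/-- [folklore] Hence the difference of two pointwise zero-mode-free `LocStencil₂` tables is pointwise zero-mode-free at that bond. -/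
theorem inner_sub_eq_zero_of_locStencil₂ (hX : LocStencil₂ X C δ) (hδ : 0 < δ) (hY : LocStencil₂ Y C' δ') (hδ' : 0 < δ')
    {κ : Fin (d + 1)} {u : Fin (d + 1) → ℤ} {κ' : Fin (d + 1)} {a b : Fib d}
    (hIX : (∑' u', ∑' x, ∑' z, X κ u κ' u' x z a b) = 0) (hIY : (∑' u', ∑' x, ∑' z, Y κ u κ' u' x z a b) = 0) :
    (∑' u', ∑' x, ∑' z, (X - Y) κ u κ' u' x z a b) = 0 := by
  rw [inner_sub_of_locStencil₂ hX hδ hY hδ' κ u κ' a b, hIX, hIY, sub_zero]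

/-! ## §3 Order independence of the inner sum -/

/-- [folklore] **THE INNER SUM MAY BE READ IN THE ORDER `Σ'_z Σ'_x Σ'_{u′}`** (the order in which the three-leg push of the slice `X κ u`
produces it): `Σ'_{u′} Σ'_x Σ'_z X κ u κ′ u′ x z a b = Σ'_z Σ'_x Σ'_{u′} X κ u κ′ u′ x z a b`. -/
theorem inner_eq_inner_zxu (hX : LocStencil₂ X C δ) (hδ : 0 < δ) (κ : Fin (d + 1)) (u : Fin (d + 1) → ℤ) (κ' : Fin (d + 1))
    (a b : Fib d) :
    (∑' u', ∑' x, ∑' z, X κ u κ' u' x z a b) = ∑' z, ∑' x, ∑' u', X κ u κ' u' x z a b := by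
  -- the absolutely convergent sum over `Site × (Site × Site)` in the variables `(u′, (x, z))`
  have hG := summable_u'xz hX hδ κ u κ' a b
  -- re-index by the involution `(u′, (x, z)) ↦ (z, (x, u′))`
  let e : ((Fin (d + 1) → ℤ) × ((Fin (d + 1) → ℤ) × (Fin (d + 1) → ℤ))) ≃
      ((Fin (d + 1) → ℤ) × ((Fin (d + 1) → ℤ) × (Fin (d + 1) → ℤ))) :=
    { toFun := fun q => (q.2.2, (q.2.1, q.1))
      invFun := fun q => (q.2.2, (q.2.1, q.1))
      left_inv := fun q => rfl
      right_inv := fun q => rfl }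
  have hH : Summable fun q : (Fin (d + 1) → ℤ) × ((Fin (d + 1) → ℤ) × (Fin (d + 1) → ℤ)) => X κ u κ' q.2.2 q.2.1 q.1 a b := by
    have := (e.summable_iff (f := fun q : (Fin (d + 1) → ℤ) × ((Fin (d + 1) → ℤ) × (Fin (d + 1) → ℤ)) =>
      X κ u κ' q.1 q.2.1 q.2.2 a b)).mpr hG
    exact this
  rw [inner_eq_tsum_prod hX hδ κ u κ' a b]
  -- `Σ'_q G q = Σ'_q G (e q) = Σ'_q H q`
  rw [← e.tsum_eq (fun q : (Fin (d + 1) → ℤ) × ((Fin (d + 1) → ℤ) × (Fin (d + 1) → ℤ)) => X κ u κ' q.1 q.2.1 q.2.2 a b)]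
  show (∑' q : (Fin (d + 1) → ℤ) × ((Fin (d + 1) → ℤ) × (Fin (d + 1) → ℤ)), X κ u κ' q.2.2 q.2.1 q.1 a b) = _
  rw [hH.tsum_prod]
  refine tsum_congr fun z => ?_
  exact (hH.prod_factor z).tsum_prod

end Summit.QuantumFields.BalabanUV.Beta.GAN24.TransversalZeroModeLoc

end
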